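import Literature.NumberTheory.Rogawski1990.UnitStableOrbitalIntegralHSideValueTypeTwo      -- ★ p841506 (F11-d): cyclic-frame algebra, L_w instance block (+ ★ (β2′-i) `exists_valuation_eq_valuation_zpow`)
import Literature.NumberTheory.Automorphic.AnisotropicUnitaryGroupCompact                  -- ★ `HermitianLattice.isCompact_setOf_v_le_exp_int`
import Literature.NumberTheory.Automorphic.AdicCompletionCompact                          -- ★ `compactSpace_integer_adicCompletion`
import Literature.NumberTheory.GaloisRepresentations.DeligneSerreGL2SubgroupsProofs           -- ★ `TwoByTwo.det_smul_one_add_smul` (norm form of `K[g]`)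
import HarnessLib

/-!
# The centraliser of a TYPE-(2) element of `U(Φ₂)(L⁺_v)` (characteristic polynomial without root in `L_w`) is COMPACT at a non-split place
# (the anisotropic torus `(EL)¹`; Rogawski 1990 §3.6, Flicker 1998 p. 97)

Topic `NumberTheory/Automorphic`; namespace `Literature.NumberTheory.Automorphic.UnitaryGroup`.  THEOREMS ONLY (no definition, no instance, no notation, no named
fact, no `sorry`).  Cell `pub/hodgecm-mathlib`, F0∕P3a road «D-N7-inert» ∕ MAP v3 (F11-d): brick **(E4′)** — discharges the one remaining binder `[CompactSpace Z(γ₂)]` of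
★ p841506 `classOrbitalIntegral_indicator_eq_phiHtwo_of_not_exists_isRoot` (the `stub_irredHValue` payer).  HC_CM is proved only modulo the printed citations until rung 0
closes; this file is unconditional and elementary.

THE MATHEMATICS.  `g = (γ₂)_w ∈ GL₂(L_w)` has `g₁₀ ≠ 0` (no eigenvalue in `L_w`), so `e₀` is a cyclic vector and the commutant of `g` is `{a·1 + b·g}` (§1).  For
`z = a + b g` unitary, `|det z| = 1` and `4 det z = (2a + b·tr g)² − b²(tr² − 4 det)`; the discriminant has ODD order `2N+1`, so the two terms never cancel and
`|a|, |b| ≤ |ϖ^{−N}|` (§2).  Hence `Z(g)` is the continuous image of a compact subset of `L_w²` (closed balls are compact, ★ `compactSpace_integer_adicCompletion`), so it is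
compact in the one-place model `U(σ_w, (Φ₂)_w)` (§3), and — along ★ `localNonsplitEquiv` — in `U(Φ₂)(L⁺_v)` (§4).

## References
* [Rogawski1990] J. D. Rogawski, *Automorphic Representations of Unitary Groups in Three Variables* (1990), §3.6 pp. 31–32, §4.9 Prop. 4.9.1 (b) p. 55.
* [Flicker1998UnitaryFL] Y. Z. Flicker, *Elementary proof of the fundamental lemma for a unitary group*, Canad. J. Math. 50 (1998), §6 p. 97.
* [PlatonovRapinchuk1994] V. Platonov, A. Rapinchuk, *Algebraic Groups and Number Theory* (1994), §3.3 (anisotropic tori over local fields are compact).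
-/

set_option autoImplicit false

noncomputable section

open NumberField IsDedekindDomain Matrix Topology ValuativeRel
open scoped ValuativeRel Matrix MatrixGroups

namespace Literature.NumberTheory.Automorphic.UnitaryGroup

open Literature.NumberTheory.Rogawski1990

/-! ## §1 The commutant of a cyclic `2 × 2` matrix (any field) -/

section Commutant

variable {K : Type*} [Field K] (σ : K →+* K)

/-- **The commutant of `g` with `g₁₀ ≠ 0` is `{a·1 + b·g}`**: if `z` commutes with `g` then `z = a·1 + b·g` with `b = z₁₀ ∕ g₁₀`, `a = z₀₀ − b g₀₀`.
[cite: Rogawski1990, §3.6 p. 31] -/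
theorem eq_smul_one_add_smul_of_commute (g z : Matrix (Fin 2) (Fin 2) K) (hg : g 1 0 ≠ 0) (h : Commute z g) :
    z = (z 0 0 - z 1 0 / g 1 0 * g 0 0) • (1 : Matrix (Fin 2) (Fin 2) K) + (z 1 0 / g 1 0) • g := by
  have hc := h.eq
  have e00 := congrFun (congrFun hc 0) 0
  have e10 := congrFun (congrFun hc 1) 0
  simp only [Matrix.mul_apply, Fin.sum_univ_two] at e00 e10
  have h01 : z 0 1 = z 1 0 / g 1 0 * g 0 1 := by field_simp; linear_combination e00
  have h11 : z 1 1 = (z 0 0 - z 1 0 / g 1 0 * g 0 0) + z 1 0 / g 1 0 * g 1 1 := by field_simp; linear_combination e10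
  ext i j
  fin_cases i <;> fin_cases j
  · simp
  · simp; exact h01
  · simp; field_simp
  · simp; rw [h11]

/-- **A matrix unitary for `!![0, 1; 1, 0]` has `σ(det z) · det z = 1`.** [cite: Rogawski1990, §3.1 p. 19] -/
theorem map_det_mul_det_eq_one_of_unitary_antidiagOne (z : Matrix (Fin 2) (Fin 2) K)
    (hz : (z.map σ)ᵀ * (!![0, 1; 1, 0] : Matrix (Fin 2) (Fin 2) K) * z = !![0, 1; 1, 0]) : σ z.det * z.det = 1 := by
  have h := congrArg Matrix.det hz
  rw [Matrix.det_mul, Matrix.det_mul, Matrix.det_transpose, Matrix.det_fin_two_of] at h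
  have hσ : (z.map σ).det = σ z.det := by
    rw [Matrix.det_fin_two, Matrix.det_fin_two]; simp [Matrix.map_apply]
  rw [hσ] at h
  norm_num at h
  exact h

/-- **The inverse of a unitary matrix**: `z⁻¹ = Φ ᵗ(σz) Φ` for `Φ = !![0, 1; 1, 0]` (`Φ² = 1`). [cite: Rogawski1990, §3.1 p. 19] -/
theorem inv_eq_of_unitary_antidiagOne (z : Matrix (Fin 2) (Fin 2) K)
    (hz : (z.map σ)ᵀ * (!![0, 1; 1, 0] : Matrix (Fin 2) (Fin 2) K) * z = !![0, 1; 1, 0]) :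
    z⁻¹ = (!![0, 1; 1, 0] : Matrix (Fin 2) (Fin 2) K) * (z.map σ)ᵀ * !![0, 1; 1, 0] := by
  have hΦ : (!![0, 1; 1, 0] : Matrix (Fin 2) (Fin 2) K) * !![0, 1; 1, 0] = 1 := by
    rw [Matrix.mul_fin_two, Matrix.one_fin_two]; norm_num
  refine Matrix.inv_eq_left_inv ?_
  calc (!![0, 1; 1, 0] : Matrix (Fin 2) (Fin 2) K) * (z.map σ)ᵀ * !![0, 1; 1, 0] * z
      = !![0, 1; 1, 0] * ((z.map σ)ᵀ * !![0, 1; 1, 0] * z) := by simp only [Matrix.mul_assoc]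
    _ = 1 := by rw [hz, hΦ]

end Commutant

/-! ## §2 The norm-form bound (any discretely valued field with `|2| = 1`) -/

section Bound

variable {F : Type*} [Field F] [ValuativeRel F] {ϖ : F} (hϖ : IsUniformizingElement ϖ)

include hϖ in
/-- **THE BOUND**: `|2| = 1`, `t ∈ 𝒪`, `|t² − 4d| = |ϖ^{2N+1}|` (odd), `|a² + a b t + b² d| = 1` ⟹ `|a|, |b| ≤ |ϖ^{−N}|` — since `4(a² + abt + b²d) = (2a + bt)² − b²(t² − 4d)`
and an even and an odd power of `ϖ` never cancel. [cite: Flicker1998UnitaryFL, §6 p. 97] [cite: PlatonovRapinchuk1994, §3.3] -/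
theorem valuation_le_of_norm_eq_one [IsDiscreteValuationRing 𝒪[F]] (h2 : valuation F 2 = 1) {t d : F} (ht : t ∈ 𝒪[F]) {N : ℕ}
    (hD : valuation F (t ^ 2 - 4 * d) = valuation F (ϖ ^ (2 * N + 1))) {a b : F} (hab : valuation F (a ^ 2 + a * b * t + b ^ 2 * d) = 1) :
    valuation F a ≤ valuation F (ϖ ^ (-(N : ℤ))) ∧ valuation F b ≤ valuation F (ϖ ^ (-(N : ℤ))) := by
  have h0 := hϖ.ne_zero
  have h4 : valuation F 4 = 1 := by rw [show (4 : F) = 2 * 2 by norm_num, map_mul, h2, mul_one]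
  have hsq : 4 * (a ^ 2 + a * b * t + b ^ 2 * d) = (2 * a + b * t) ^ 2 - b ^ 2 * (t ^ 2 - 4 * d) := by ring
  have hval : valuation F ((2 * a + b * t) ^ 2 - b ^ 2 * (t ^ 2 - 4 * d)) = 1 := by rw [← hsq, map_mul, h4, one_mul, hab]
  have hD' : valuation F (t ^ 2 - 4 * d) = valuation F (ϖ ^ (((2 * N + 1 : ℕ)) : ℤ)) := by rw [zpow_natCast]; exact hD
  have one_eq : (1 : ValueGroupWithZero F) = valuation F (ϖ ^ (0 : ℤ)) := by rw [zpow_zero, map_one]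
  -- `|a| ≤ max(|2a + bt|, |b|)`-type bookkeeping: from `|x| ≤ 1 = |ϖ^0|` for both summands
  have key : valuation F ((2 * a + b * t) ^ 2) ≤ 1 ∧ valuation F (b ^ 2 * (t ^ 2 - 4 * d)) ≤ 1 := by
    by_cases hb : b = 0
    · subst hb
      simp only [zero_pow two_ne_zero, zero_mul, sub_zero] at hval ⊢
      exact ⟨hval.le, by rw [map_zero]; exact zero_le⟩
    by_cases hs : 2 * a + b * t = 0
    · rw [hs, zero_pow two_ne_zero, zero_sub, Valuation.map_neg] at hval
      exact ⟨by rw [hs, zero_pow two_ne_zero, map_zero]; exact zero_le, hval.le⟩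
    obtain ⟨m, hm⟩ := exists_valuation_eq_valuation_zpow hϖ hb
    obtain ⟨m', hm'⟩ := exists_valuation_eq_valuation_zpow hϖ hs
    have h1 : valuation F ((2 * a + b * t) ^ 2) = valuation F (ϖ ^ (2 * m')) := by
      rw [map_pow, hm', ← map_pow, ← zpow_natCast, ← _root_.zpow_mul, mul_comm]; rfl
    have h2' : valuation F (b ^ 2 * (t ^ 2 - 4 * d)) = valuation F (ϖ ^ (2 * m + (2 * N + 1 : ℕ))) := by
      rw [map_mul, map_pow, hm, hD', ← map_pow, ← map_mul, ← zpow_natCast (ϖ ^ m), ← _root_.zpow_mul, ← zpow_add₀ h0, mul_comm]; rfl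
    have hne : valuation F ((2 * a + b * t) ^ 2) ≠ valuation F (b ^ 2 * (t ^ 2 - 4 * d)) := by
      rw [h1, h2']
      intro h
      have ha' := (valuation_zpow_le_valuation_zpow_iff hϖ _ _).1 h.le
      have hb' := (valuation_zpow_le_valuation_zpow_iff hϖ _ _).1 h.ge
      push_cast at ha' hb'; omega
    have hmax : valuation F ((2 * a + b * t) ^ 2 - b ^ 2 * (t ^ 2 - 4 * d)) =
        max (valuation F ((2 * a + b * t) ^ 2)) (valuation F (b ^ 2 * (t ^ 2 - 4 * d))) := by
      rw [sub_eq_add_neg, Valuation.map_add_of_distinct_val _ (by rwa [Valuation.map_neg]), Valuation.map_neg]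
    rw [hmax] at hval
    exact ⟨hval ▸ le_max_left _ _, hval ▸ le_max_right _ _⟩
  obtain ⟨hA, hB⟩ := key
  -- `|b| ≤ |ϖ^{-N}|`
  have hb : valuation F b ≤ valuation F (ϖ ^ (-(N : ℤ))) := by
    by_cases hb0 : b = 0
    · rw [hb0, map_zero]; exact zero_le
    obtain ⟨m, hm⟩ := exists_valuation_eq_valuation_zpow hϖ hb0
    have h2' : valuation F (b ^ 2 * (t ^ 2 - 4 * d)) = valuation F (ϖ ^ (2 * m + (2 * N + 1 : ℕ))) := by
      rw [map_mul, map_pow, hm, hD', ← map_pow, ← map_mul, ← zpow_natCast (ϖ ^ m), ← _root_.zpow_mul, ← zpow_add₀ h0, mul_comm]; rfl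
    rw [h2', one_eq, valuation_zpow_le_valuation_zpow_iff hϖ] at hB
    rw [hm, valuation_zpow_le_valuation_zpow_iff hϖ]
    push_cast at hB; omega
  refine ⟨?_, hb⟩
  -- `|2a| ≤ max(|2a + bt|, |bt|) ≤ |ϖ^{-N}|`
  have h2a : valuation F (2 * a) = valuation F a := by rw [map_mul, h2, one_mul]
  have hs1 : valuation F (2 * a + b * t) ≤ 1 := by
    by_contra hlt
    rw [not_le] at hlt
    have : 1 < valuation F ((2 * a + b * t) ^ 2) := by rw [map_pow]; exact one_lt_pow₀ hlt two_ne_zero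
    exact absurd hA this.not_ge
  have hbt : valuation F (b * t) ≤ valuation F (ϖ ^ (-(N : ℤ))) := by
    rw [map_mul]
    exact le_trans (mul_le_of_le_one_right' ((Valuation.mem_integer_iff _ _).1 ht)) hb
  have hN0 : (1 : ValueGroupWithZero F) ≤ valuation F (ϖ ^ (-(N : ℤ))) := by
    rw [one_eq, valuation_zpow_le_valuation_zpow_iff hϖ]; omega
  rw [← h2a, show 2 * a = (2 * a + b * t) - b * t by ring]
  exact le_trans (Valuation.map_sub _ _ _) (max_le (le_trans hs1 hN0) hbt)

end Bound



/-! ## §3 Compactness in the one-place model `U(σ_w, (Φ₂)_w) ≤ GL₂(L_w)` -/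

section OnePlace

variable (L : Type) [Field L] [NumberField L] [IsCMField L] (v : HeightOneSpectrum (𝓞 ↥(maximalRealSubfield L)))
  (w : PlacesOver L v) (hw : IsCMField.complexConj L • w.1 = w.1)

omit [IsCMField L] in
/-- `(Φ₂)_w = !![0, 1; 1, 0]`. [folklore] -/
private theorem placeForm_antidiagTwo_eq'' :
    placeForm (Matrix.of fun i j : Fin 2 => if i.val + j.val + 1 = 2 then (1 : L) else 0) w.1 = (!![0, 1; 1, 0] : Matrix (Fin 2) (Fin 2) (w.1.adicCompletion L)) := by
  ext i j
  fin_cases i <;> fin_cases j <;> simp [placeForm, Matrix.map_apply]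

include hw in
/-- **COMPACT CENTRALISER IN THE ONE-PLACE MODEL**: for `u ∈ U(σ_w, (Φ₂)_w)` whose matrix `g` has `g₁₀ ≠ 0`, `tr g ∈ 𝒪`, `|2| = 1` and `|tr² − 4det| = |ϖ^(2N+1)|`, the
centraliser of `u` is compact: it is the continuous image of the compact set `{(a,b) : |a|,|b| ≤ |ϖ^(−N)|, a + bg unitary}` (§1, §2). [cite: Rogawski1990, §3.6 pp. 31–32]
[cite: PlatonovRapinchuk1994, §3.3] -/
theorem isCompact_centralizer_onePlace_of_cyclic (hunr : Algebra.IsUnramifiedIn (𝓞 L) v.asIdeal) (u : (unitaryGroupOfForm (galAdicCompletionMap (L := L) (IsCMField.complexConj L) hw) (placeForm (Matrix.of fun i j : Fin 2 => if i.val + j.val + 1 = 2 then (1 : L) else 0) w.1)))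
    (hg10 : ((u : GL (Fin 2) (w.1.adicCompletion L)) : Matrix (Fin 2) (Fin 2) (w.1.adicCompletion L)) 1 0 ≠ 0)
    (h2 : valuation (w.1.adicCompletion L) 2 = 1) (ht : ((u : GL (Fin 2) (w.1.adicCompletion L)) : Matrix (Fin 2) (Fin 2) (w.1.adicCompletion L)).trace ∈ 𝒪[(w.1.adicCompletion L)]) {N : ℕ}
    (hD : valuation (w.1.adicCompletion L) (((u : GL (Fin 2) (w.1.adicCompletion L)) : Matrix (Fin 2) (Fin 2) (w.1.adicCompletion L)).trace ^ 2 - 4 * ((u : GL (Fin 2) (w.1.adicCompletion L)) : Matrix (Fin 2) (Fin 2) (w.1.adicCompletion L)).det) =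
      valuation (w.1.adicCompletion L) ((toPlace v w (GaloisRepresentations.HeckeCharacter.uniformizer ↥(maximalRealSubfield L) v : v.adicCompletion ↥(maximalRealSubfield L))) ^ (2 * N + 1))) :
    IsCompact ((Subgroup.centralizer ({u} : Set (unitaryGroupOfForm (galAdicCompletionMap (L := L) (IsCMField.complexConj L) hw) (placeForm (Matrix.of fun i j : Fin 2 => if i.val + j.val + 1 = 2 then (1 : L) else 0) w.1))) : Subgroup (unitaryGroupOfForm (galAdicCompletionMap (L := L) (IsCMField.complexConj L) hw) (placeForm (Matrix.of fun i j : Fin 2 => if i.val + j.val + 1 = 2 then (1 : L) else 0) w.1))) : Set (unitaryGroupOfForm (galAdicCompletionMap (L := L) (IsCMField.complexConj L) hw) (placeForm (Matrix.of fun i j : Fin 2 => if i.val + j.val + 1 = 2 then (1 : L) else 0) w.1))) := by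
  classical
  have hc1 : IsCMField.complexConj L ≠ 1 := IsCMField.complexConj_ne_one L
  have hϖv := Liu2021.LemD1IndexedNonVacuityInertCofinite.valued_toPlace_uniformizer_of_isUnramifiedIn L v hunr w
  have hϖ : IsUniformizingElement (toPlace v w (GaloisRepresentations.HeckeCharacter.uniformizer ↥(maximalRealSubfield L) v : v.adicCompletion ↥(maximalRealSubfield L))) := isUniformizingElement_of_v_eq hϖv
  haveI : IsDiscreteValuationRing 𝒪[(w.1.adicCompletion L)] := isDiscreteValuationRing_integer_of_compatible hϖv
  haveI := compactSpace_integer_adicCompletion L w.1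
  have hσc : Continuous (galAdicCompletionMap (L := L) (IsCMField.complexConj L) hw) := continuous_galAdicCompletionMap L (IsCMField.complexConj L) hw
  obtain ⟨g, hg⟩ : ∃ g : Matrix (Fin 2) (Fin 2) (w.1.adicCompletion L), ((u : GL (Fin 2) (w.1.adicCompletion L)) : Matrix (Fin 2) (Fin 2) (w.1.adicCompletion L)) = g := ⟨_, rfl⟩
  rw [hg] at hg10 ht hD
  have hgU : (g.map (galAdicCompletionMap (L := L) (IsCMField.complexConj L) hw))ᵀ * (!![0, 1; 1, 0] : Matrix (Fin 2) (Fin 2) (w.1.adicCompletion L)) * g = !![0, 1; 1, 0] := by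
    rw [← hg, ← placeForm_antidiagTwo_eq'' L v w]
    exact (mem_unitaryGroupOfForm_iff (σ := (galAdicCompletionMap (L := L) (IsCMField.complexConj L) hw)) (J := placeForm (Matrix.of fun i j : Fin 2 => if i.val + j.val + 1 = 2 then (1 : L) else 0) w.1) (g := (u : GL (Fin 2) (w.1.adicCompletion L)))).1 u.2
  -- the parameter set
  set M : (w.1.adicCompletion L) × (w.1.adicCompletion L) → Matrix (Fin 2) (Fin 2) (w.1.adicCompletion L) := fun p => p.1 • (1 : Matrix (Fin 2) (Fin 2) (w.1.adicCompletion L)) + p.2 • g with hM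
  have hMc : Continuous M := (continuous_fst.smul continuous_const).add (continuous_snd.smul continuous_const)
  set S : Set ((w.1.adicCompletion L) × (w.1.adicCompletion L)) := ({x : (w.1.adicCompletion L) | Valued.v x ≤ WithZero.exp (N : ℤ)} ×ˢ {x : (w.1.adicCompletion L) | Valued.v x ≤ WithZero.exp (N : ℤ)}) ∩
    {p | ((M p).map (galAdicCompletionMap (L := L) (IsCMField.complexConj L) hw))ᵀ * (!![0, 1; 1, 0] : Matrix (Fin 2) (Fin 2) (w.1.adicCompletion L)) * M p = !![0, 1; 1, 0]} with hS
  have hSc : IsCompact S := by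
    refine ((HermitianLattice.isCompact_setOf_v_le_exp_int hϖv N).prod (HermitianLattice.isCompact_setOf_v_le_exp_int hϖv N)).inter_right ?_
    exact isClosed_eq (((hMc.matrix_map hσc).matrix_transpose.matrix_mul continuous_const).matrix_mul hMc) continuous_const
  haveI : CompactSpace S := isCompact_iff_compactSpace.1 hSc
  -- the map `S → U_w`
  have hinv : ∀ p : S, (!![0, 1; 1, 0] : Matrix (Fin 2) (Fin 2) (w.1.adicCompletion L)) * ((M p.1).map (galAdicCompletionMap (L := L) (IsCMField.complexConj L) hw))ᵀ * !![0, 1; 1, 0] * M p.1 = 1 := fun p => by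
    have hΦ : (!![0, 1; 1, 0] : Matrix (Fin 2) (Fin 2) (w.1.adicCompletion L)) * !![0, 1; 1, 0] = 1 := by rw [Matrix.mul_fin_two, Matrix.one_fin_two]; norm_num
    calc (!![0, 1; 1, 0] : Matrix (Fin 2) (Fin 2) (w.1.adicCompletion L)) * ((M p.1).map (galAdicCompletionMap (L := L) (IsCMField.complexConj L) hw))ᵀ * !![0, 1; 1, 0] * M p.1
        = !![0, 1; 1, 0] * (((M p.1).map (galAdicCompletionMap (L := L) (IsCMField.complexConj L) hw))ᵀ * !![0, 1; 1, 0] * M p.1) := by simp only [Matrix.mul_assoc]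
      _ = 1 := by rw [p.2.2, hΦ]
  let φGL : S → GL (Fin 2) (w.1.adicCompletion L) := fun p =>
    ⟨M p.1, (!![0, 1; 1, 0] : Matrix (Fin 2) (Fin 2) (w.1.adicCompletion L)) * ((M p.1).map (galAdicCompletionMap (L := L) (IsCMField.complexConj L) hw))ᵀ * !![0, 1; 1, 0], mul_eq_one_comm.1 (hinv p), hinv p⟩
  have hφGLc : Continuous φGL := by
    refine Units.continuous_iff.2 ⟨?_, ?_⟩
    · show Continuous fun p : S => M p.1
      exact hMc.comp continuous_subtype_val
    · show Continuous fun p : S => (!![0, 1; 1, 0] : Matrix (Fin 2) (Fin 2) (w.1.adicCompletion L)) * ((M p.1).map (galAdicCompletionMap (L := L) (IsCMField.complexConj L) hw))ᵀ * !![0, 1; 1, 0]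
      exact (continuous_const.matrix_mul ((hMc.comp continuous_subtype_val).matrix_map hσc).matrix_transpose).matrix_mul continuous_const
  let φ : S → (unitaryGroupOfForm (galAdicCompletionMap (L := L) (IsCMField.complexConj L) hw) (placeForm (Matrix.of fun i j : Fin 2 => if i.val + j.val + 1 = 2 then (1 : L) else 0) w.1)) := fun p => ⟨φGL p, (mem_unitaryGroupOfForm_iff (σ := (galAdicCompletionMap (L := L) (IsCMField.complexConj L) hw)) (J := placeForm (Matrix.of fun i j : Fin 2 => if i.val + j.val + 1 = 2 then (1 : L) else 0) w.1)).2 (by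
    rw [placeForm_antidiagTwo_eq'' L v w]; exact p.2.2)⟩
  have hφc : Continuous φ := hφGLc.subtype_mk _
  -- its range is the centraliser
  have hrange : Set.range φ = ((Subgroup.centralizer ({u} : Set (unitaryGroupOfForm (galAdicCompletionMap (L := L) (IsCMField.complexConj L) hw) (placeForm (Matrix.of fun i j : Fin 2 => if i.val + j.val + 1 = 2 then (1 : L) else 0) w.1))) : Subgroup (unitaryGroupOfForm (galAdicCompletionMap (L := L) (IsCMField.complexConj L) hw) (placeForm (Matrix.of fun i j : Fin 2 => if i.val + j.val + 1 = 2 then (1 : L) else 0) w.1))) : Set (unitaryGroupOfForm (galAdicCompletionMap (L := L) (IsCMField.complexConj L) hw) (placeForm (Matrix.of fun i j : Fin 2 => if i.val + j.val + 1 = 2 then (1 : L) else 0) w.1))) := by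
    ext z
    simp only [Set.mem_range, SetLike.mem_coe, Subgroup.mem_centralizer_singleton_iff]
    constructor
    · rintro ⟨p, rfl⟩
      apply Subtype.ext; apply Units.ext
      show M p.1 * ((u : GL (Fin 2) (w.1.adicCompletion L)) : Matrix (Fin 2) (Fin 2) (w.1.adicCompletion L)) = ((u : GL (Fin 2) (w.1.adicCompletion L)) : Matrix (Fin 2) (Fin 2) (w.1.adicCompletion L)) * M p.1
      rw [hg, hM]
      simp only [Matrix.add_mul, Matrix.mul_add, Matrix.smul_mul, Matrix.mul_smul, Matrix.one_mul, Matrix.mul_one]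
    · intro hz
      have hcomm : Commute ((z : GL (Fin 2) (w.1.adicCompletion L)) : Matrix (Fin 2) (Fin 2) (w.1.adicCompletion L)) g := by
        rw [← hg]; exact congrArg (fun x : (unitaryGroupOfForm (galAdicCompletionMap (L := L) (IsCMField.complexConj L) hw) (placeForm (Matrix.of fun i j : Fin 2 => if i.val + j.val + 1 = 2 then (1 : L) else 0) w.1)) => ((x : GL (Fin 2) (w.1.adicCompletion L)) : Matrix (Fin 2) (Fin 2) (w.1.adicCompletion L))) hz
      have hzU : (((z : GL (Fin 2) (w.1.adicCompletion L)) : Matrix (Fin 2) (Fin 2) (w.1.adicCompletion L)).map (galAdicCompletionMap (L := L) (IsCMField.complexConj L) hw))ᵀ * (!![0, 1; 1, 0] : Matrix (Fin 2) (Fin 2) (w.1.adicCompletion L)) *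
          ((z : GL (Fin 2) (w.1.adicCompletion L)) : Matrix (Fin 2) (Fin 2) (w.1.adicCompletion L)) = !![0, 1; 1, 0] := by
        rw [← placeForm_antidiagTwo_eq'' L v w]
        exact (mem_unitaryGroupOfForm_iff (σ := (galAdicCompletionMap (L := L) (IsCMField.complexConj L) hw)) (J := placeForm (Matrix.of fun i j : Fin 2 => if i.val + j.val + 1 = 2 then (1 : L) else 0) w.1) (g := (z : GL (Fin 2) (w.1.adicCompletion L)))).1 z.2
      set a : (w.1.adicCompletion L) := ((z : GL (Fin 2) (w.1.adicCompletion L)) : Matrix (Fin 2) (Fin 2) (w.1.adicCompletion L)) 0 0 - ((z : GL (Fin 2) (w.1.adicCompletion L)) : Matrix (Fin 2) (Fin 2) (w.1.adicCompletion L)) 1 0 / g 1 0 * g 0 0 with ha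
      set b : (w.1.adicCompletion L) := ((z : GL (Fin 2) (w.1.adicCompletion L)) : Matrix (Fin 2) (Fin 2) (w.1.adicCompletion L)) 1 0 / g 1 0 with hb
      have hzab : ((z : GL (Fin 2) (w.1.adicCompletion L)) : Matrix (Fin 2) (Fin 2) (w.1.adicCompletion L)) = M (a, b) := eq_smul_one_add_smul_of_commute g _ hg10 hcomm
      -- `|det z| = 1` ⇒ the bound
      have hdet1 : valuation (w.1.adicCompletion L) (a ^ 2 + a * b * g.trace + b ^ 2 * g.det) = 1 := by
        rw [← GaloisRepresentations.DeligneSerre1974.TwoByTwo.det_smul_one_add_smul]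
        have h1 := map_det_mul_det_eq_one_of_unitary_antidiagOne (galAdicCompletionMap (L := L) (IsCMField.complexConj L) hw) _ hzU
        rw [hzab] at h1
        exact valuation_eq_one_of_galAdicCompletionMap_mul_self L v w hw h1
      obtain ⟨hva, hvb⟩ := valuation_le_of_norm_eq_one hϖ h2 ht hD hdet1
      have hexp : ∀ x : (w.1.adicCompletion L), valuation (w.1.adicCompletion L) x ≤ valuation (w.1.adicCompletion L) ((toPlace v w (GaloisRepresentations.HeckeCharacter.uniformizer ↥(maximalRealSubfield L) v : v.adicCompletion ↥(maximalRealSubfield L))) ^ (-(N : ℤ))) → Valued.v x ≤ WithZero.exp (N : ℤ) := fun x hx => by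
        have h := (v_le_iff_valuation_le x _).2 hx
        rwa [valued_toPlace_uniformizer_zpow L v w hunr, neg_neg] at h
      refine ⟨⟨(a, b), ⟨⟨hexp a hva, hexp b hvb⟩, show ((M (a, b)).map _)ᵀ * _ * M (a, b) = _ by rw [← hzab]; exact hzU⟩⟩, ?_⟩
      apply Subtype.ext; apply Units.ext
      exact hzab.symm
  rw [← hrange]
  exact isCompact_range hφc

end OnePlace

/-! ## §4 Transfer to `U(Φ₂)(L⁺_v)` and the hypothesis-free type-(2) H-side value -/

section CM

variable (L : Type) [Field L] [NumberField L] [IsCMField L] (v : HeightOneSpectrum (𝓞 ↥(maximalRealSubfield L)))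
  (w : PlacesOver L v) (hw : IsCMField.complexConj L • w.1 = w.1)

include hw in
/-- **THE CENTRALISER OF A TYPE-(2) ELEMENT IS COMPACT** (stub frame of `stub_irredHValue`): for `γ_H = (γ₂, γ₁)` with `χ_{ι(γ_H),w}` integral (`hint`), `2 ∈ 𝒪_w^×`,
`χ_{γ₂,w}` without root in `L_w`, `|tr² − 4det| = exp(−(2N+1))`, at a non-split `v` unramified in `L`: `Z(γ₂) ≤ U(Φ₂)(L⁺_v)` is compact (§3 along ★ `localNonsplitEquiv`).
[cite: Rogawski1990, §3.6 pp. 31–32] [cite: PlatonovRapinchuk1994, §3.3] -/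
theorem compactSpace_centralizer_of_not_exists_isRoot (hunr : Algebra.IsUnramifiedIn (𝓞 L) v.asIdeal)
    (γH : (cmDatum L 2 (Matrix.of fun i j : Fin 2 => if i.val + j.val + 1 = 2 then (1 : L) else 0)).Local v × (cmDatum L 1 (Matrix.of fun i j : Fin 1 => if i.val + j.val + 1 = 1 then (1 : L) else 0)).Local v) (h2 : IsUnit (2 : 𝒪[(w.1.adicCompletion L)]))
    (hint : ∀ i : ℕ, ((((endoEmbLocal L v γH).val : GL (Fin 3) (LocalRing L v)).val.map (Pi.evalRingHom (fun w' : PlacesOver L v => w'.1.adicCompletion L) w)).charpoly.coeff i) ∈ 𝒪[(w.1.adicCompletion L)])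
    (hirr : ¬ ∃ x : (w.1.adicCompletion L), (((((γH.1.val : GL (Fin 2) (LocalRing L v)) : Matrix (Fin 2) (Fin 2) (LocalRing L v)).map (Pi.evalRingHom (fun w' : PlacesOver L v => w'.1.adicCompletion L) w))).charpoly).IsRoot x)
    (N : ℕ) (hN : Valued.v (((((γH.1.val : GL (Fin 2) (LocalRing L v)) : Matrix (Fin 2) (Fin 2) (LocalRing L v)).map (Pi.evalRingHom (fun w' : PlacesOver L v => w'.1.adicCompletion L) w))).trace ^ 2 - 4 * ((((γH.1.val : GL (Fin 2) (LocalRing L v)) : Matrix (Fin 2) (Fin 2) (LocalRing L v)).map (Pi.evalRingHom (fun w' : PlacesOver L v => w'.1.adicCompletion L) w))).det) = WithZero.exp (-((2 * N + 1 : ℕ) : ℤ))) :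
    CompactSpace (Subgroup.centralizer ({γH.1} : Set ((cmDatum L 2 (Matrix.of fun i j : Fin 2 => if i.val + j.val + 1 = 2 then (1 : L) else 0)).Local v))) := by
  have hc1 : IsCMField.complexConj L ≠ 1 := IsCMField.complexConj_ne_one L
  have hϖv := Liu2021.LemD1IndexedNonVacuityInertCofinite.valued_toPlace_uniformizer_of_isUnramifiedIn L v hunr w
  -- the one-place image `u` of `γ₂` and its matrix `g`
  obtain ⟨g, hg⟩ : ∃ g : Matrix (Fin 2) (Fin 2) (w.1.adicCompletion L), (((γH.1.val : GL (Fin 2) (LocalRing L v)) : Matrix (Fin 2) (Fin 2) (LocalRing L v)).map (Pi.evalRingHom (fun w' : PlacesOver L v => w'.1.adicCompletion L) w)) = g := ⟨_, rfl⟩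
  rw [hg] at hirr hN
  have hcoe : ((((localNonsplitEquiv (IsCMField.complexConj L) (Matrix.of fun i j : Fin 2 => if i.val + j.val + 1 = 2 then (1 : L) else 0) (IsCMField.complexConj_ne_one L) w hw) γH.1 : (unitaryGroupOfForm (galAdicCompletionMap (L := L) (IsCMField.complexConj L) hw) (placeForm (Matrix.of fun i j : Fin 2 => if i.val + j.val + 1 = 2 then (1 : L) else 0) w.1))) : GL (Fin 2) (w.1.adicCompletion L)) : Matrix (Fin 2) (Fin 2) (w.1.adicCompletion L)) = g :=
    (coe_localNonsplitEquiv_apply L (Matrix.of fun i j : Fin 2 => if i.val + j.val + 1 = 2 then (1 : L) else 0) v w hw γH.1).trans hg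
  have hg10 : g 1 0 ≠ 0 := fun h10 => hirr ⟨g 0 0, by
    rw [Polynomial.IsRoot, Matrix.charpoly_fin_two, Matrix.trace_fin_two, Matrix.det_fin_two, h10]
    simp; ring⟩
  obtain ⟨htv, -⟩ := valued_trace_le_one_and_valued_det_le_one_of_hint L v w hw (a := γH)
    (fun i => by rw [valuedInteger_eq_integer]; exact hint i)
  rw [hg] at htv
  have ht : g.trace ∈ 𝒪[(w.1.adicCompletion L)] := (v_le_one_iff_mem_integer _).1 htv
  have h2v : valuation (w.1.adicCompletion L) 2 = 1 := by
    have := (Valuation.integer.integers (valuation (w.1.adicCompletion L))).isUnit_iff_valuation_eq_one.1 h2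
    rwa [map_ofNat] at this
  have hD : valuation (w.1.adicCompletion L) (g.trace ^ 2 - 4 * g.det) = valuation (w.1.adicCompletion L) ((toPlace v w (GaloisRepresentations.HeckeCharacter.uniformizer ↥(maximalRealSubfield L) v : v.adicCompletion ↥(maximalRealSubfield L))) ^ (2 * N + 1)) := by
    refine (v_eq_iff_valuation_eq _ _).1 ?_
    rw [hN, map_pow, hϖv, ← WithZero.exp_nsmul]
    simp
  -- §3 in the one-place model
  have hK := isCompact_centralizer_onePlace_of_cyclic L v w hw hunr ((localNonsplitEquiv (IsCMField.complexConj L) (Matrix.of fun i j : Fin 2 => if i.val + j.val + 1 = 2 then (1 : L) else 0) (IsCMField.complexConj_ne_one L) w hw) γH.1) (by rw [hcoe]; exact hg10) h2v (by rw [hcoe]; exact ht)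
    (N := N) (by rw [hcoe]; exact hD)
  haveI : CompactSpace (Subgroup.centralizer ({(localNonsplitEquiv (IsCMField.complexConj L) (Matrix.of fun i j : Fin 2 => if i.val + j.val + 1 = 2 then (1 : L) else 0) (IsCMField.complexConj_ne_one L) w hw) γH.1} : Set (unitaryGroupOfForm (galAdicCompletionMap (L := L) (IsCMField.complexConj L) hw) (placeForm (Matrix.of fun i j : Fin 2 => if i.val + j.val + 1 = 2 then (1 : L) else 0) w.1)))) := isCompact_iff_compactSpace.1 hK
  -- transport along the topological isomorphism
  have hiff : ∀ x : (cmDatum L 2 (Matrix.of fun i j : Fin 2 => if i.val + j.val + 1 = 2 then (1 : L) else 0)).Local v, x ∈ Subgroup.centralizer ({γH.1} : Set ((cmDatum L 2 (Matrix.of fun i j : Fin 2 => if i.val + j.val + 1 = 2 then (1 : L) else 0)).Local v)) ↔ (localNonsplitEquiv (IsCMField.complexConj L) (Matrix.of fun i j : Fin 2 => if i.val + j.val + 1 = 2 then (1 : L) else 0) (IsCMField.complexConj_ne_one L) w hw) x ∈ Subgroup.centralizer ({(localNonsplitEquiv (IsCMField.complexConj L) (Matrix.of fun i j : Fin 2 =>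 if i.val + j.val + 1 = 2 then (1 : L) else 0) (IsCMField.complexConj_ne_one L) w hw) γH.1} : Set (unitaryGroupOfForm (galAdicCompletionMap (L := L) (IsCMField.complexConj L) hw) (placeForm (Matrix.of fun i j : Fin 2 => if i.val + j.val + 1 = 2 then (1 : L) else 0) w.1))) := fun x => by
    rw [Subgroup.mem_centralizer_singleton_iff, Subgroup.mem_centralizer_singleton_iff, ← map_mul, ← map_mul, (localNonsplitEquiv (IsCMField.complexConj L) (Matrix.of fun i j : Fin 2 => if i.val + j.val + 1 = 2 then (1 : L) else 0) (IsCMField.complexConj_ne_one L) w hw).injective.eq_iff]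
    exact Iff.rfl
  exact (((localNonsplitEquiv (IsCMField.complexConj L) (Matrix.of fun i j : Fin 2 => if i.val + j.val + 1 = 2 then (1 : L) else 0) (IsCMField.complexConj_ne_one L) w hw).toHomeomorph).subtype hiff).symm.compactSpace

end CM

/-! ## §5 The hypothesis-free `stub_irredHValue` payer -/

section Payer

variable (L : Type) [Field L] [NumberField L] [IsCMField L] (v : HeightOneSpectrum (𝓞 ↥(maximalRealSubfield L)))
  (w : PlacesOver L v) (hw : IsCMField.complexConj L • w.1 = w.1)
  [MeasurableSpace ((cmDatum L 2 (Matrix.of fun i j : Fin 2 => if i.val + j.val + 1 = 2 then (1 : L) else 0)).Local v × (cmDatum L 1 (Matrix.of fun i j : Fin 1 => if i.val + j.val + 1 = 1 then (1 : L) else 0)).Local v)] [BorelSpace ((cmDatum L 2 (Matrix.of fun i j : Fin 2 => if i.val + j.val + 1 = 2 then (1 : L) else 0)).Local v × (cmDatum L 1 (Matrix.of fun i j : Fin 1 => if i.val + j.val + 1 = 1 then (1 : L) else 0)).Local v)]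
  [∀ a : (cmDatum L 2 (Matrix.of fun i j : Fin 2 => if i.val + j.val + 1 = 2 then (1 : L) else 0)).Local v × (cmDatum L 1 (Matrix.of fun i j : Fin 1 => if i.val + j.val + 1 = 1 then (1 : L) else 0)).Local v, MeasurableSpace (((cmDatum L 2 (Matrix.of fun i j : Fin 2 => if i.val + j.val + 1 = 2 then (1 : L) else 0)).Local v × (cmDatum L 1 (Matrix.of fun i j : Fin 1 => if i.val + j.val + 1 = 1 then (1 : L) else 0)).Local v) ⧸ Subgroup.centralizer ({a} : Set ((cmDatum L 2 (Matrix.of fun i j : Fin 2 => if i.val + j.val + 1 = 2 then (1 : L) else 0)).Local v × (cmDatum L 1 (Matrix.of fun i j : Fin 1 => if i.val + j.val + 1 = 1 then (1 : L) else 0)).Local v)))]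
  [∀ a : (cmDatum L 2 (Matrix.of fun i j : Fin 2 => if i.val + j.val + 1 = 2 then (1 : L) else 0)).Local v × (cmDatum L 1 (Matrix.of fun i j : Fin 1 => if i.val + j.val + 1 = 1 then (1 : L) else 0)).Local v, BorelSpace (((cmDatum L 2 (Matrix.of fun i j : Fin 2 => if i.val + j.val + 1 = 2 then (1 : L) else 0)).Local v × (cmDatum L 1 (Matrix.of fun i j : Fin 1 => if i.val + j.val + 1 = 1 then (1 : L) else 0)).Local v) ⧸ Subgroup.centralizer ({a} : Set ((cmDatum L 2 (Matrix.of fun i j : Fin 2 => if i.val + j.val + 1 = 2 then (1 : L) else 0)).Local v × (cmDatum L 1 (Matrix.of fun i j : Fin 1 => if i.val + j.val + 1 = 1 then (1 : L) else 0)).Local v)))]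
  (νH : MeasureTheory.Measure ((cmDatum L 2 (Matrix.of fun i j : Fin 2 => if i.val + j.val + 1 = 2 then (1 : L) else 0)).Local v × (cmDatum L 1 (Matrix.of fun i j : Fin 1 => if i.val + j.val + 1 = 1 then (1 : L) else 0)).Local v)) [νH.IsHaarMeasure] [νH.IsMulRightInvariant]

include hw in
/-- **THE TYPE-(2) H-SIDE VALUE, HYPOTHESIS-FREE IN THE STUB FRAME** — `stub_irredHValue` («N7nsCount» ED. 1.3 :521) BY NAME: ★ p841506
`classOrbitalIntegral_indicator_eq_phiHtwo_of_not_exists_isRoot` with its `[CompactSpace Z(γ₂)]` instance discharged by §4.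
[cite: Flicker1998UnitaryFL, §6 p. 97] [cite: Rogawski1990, §4.9 Prop. 4.9.1 (b) p. 55] -/
theorem classOrbitalIntegral_indicator_eq_phiHtwo_of_not_exists_isRoot' (hunr : Algebra.IsUnramifiedIn (𝓞 L) v.asIdeal)
    {mH : OrbitalMeasureFamily ((cmDatum L 2 (Matrix.of fun i j : Fin 2 => if i.val + j.val + 1 = 2 then (1 : L) else 0)).Local v × (cmDatum L 1 (Matrix.of fun i j : Fin 1 => if i.val + j.val + 1 = 1 then (1 : L) else 0)).Local v)} (hmH : mH.IsCanonical (IsLocalGRegular L v) νH)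
    (hνH : νH ((((cmLocalIntegralLevel L 2 (Matrix.of fun i j : Fin 2 => if i.val + j.val + 1 = 2 then (1 : L) else 0) v).prod (cmLocalIntegralLevel L 1 (Matrix.of fun i j : Fin 1 => if i.val + j.val + 1 = 1 then (1 : L) else 0) v)) : Subgroup ((cmDatum L 2 (Matrix.of fun i j : Fin 2 => if i.val + j.val + 1 = 2 then (1 : L) else 0)).Local v × (cmDatum L 1 (Matrix.of fun i j : Fin 1 => if i.val + j.val + 1 = 1 then (1 : L) else 0)).Local v)) : Set ((cmDatum L 2 (Matrix.of fun i j : Fin 2 => if i.val + j.val + 1 = 2 then (1 : L) else 0)).Local v × (cmDatum L 1 (Matrix.of fun i j : Fin 1 => if i.val + j.val + 1 = 1 then (1 : L) else 0)).Local v)) = 1)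
    {γH : (cmDatum L 2 (Matrix.of fun i j : Fin 2 => if i.val + j.val + 1 = 2 then (1 : L) else 0)).Local v × (cmDatum L 1 (Matrix.of fun i j : Fin 1 => if i.val + j.val + 1 = 1 then (1 : L) else 0)).Local v} (hreg : IsLocalGRegular L v γH)
    (h2 : IsUnit (2 : 𝒪[(w.1.adicCompletion L)]))
    (hint : ∀ i : ℕ, ((((endoEmbLocal L v γH).val : GL (Fin 3) (LocalRing L v)).val.map (Pi.evalRingHom (fun w' : PlacesOver L v => w'.1.adicCompletion L) w)).charpoly.coeff i) ∈ 𝒪[(w.1.adicCompletion L)])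
    (hirr : ¬ ∃ x : (w.1.adicCompletion L), (((((γH.1.val : GL (Fin 2) (LocalRing L v)) : Matrix (Fin 2) (Fin 2) (LocalRing L v)).map (Pi.evalRingHom (fun w' : PlacesOver L v => w'.1.adicCompletion L) w))).charpoly).IsRoot x)
    (N : ℕ) (hN : Valued.v (((((γH.1.val : GL (Fin 2) (LocalRing L v)) : Matrix (Fin 2) (Fin 2) (LocalRing L v)).map (Pi.evalRingHom (fun w' : PlacesOver L v => w'.1.adicCompletion L) w))).trace ^ 2 - 4 * ((((γH.1.val : GL (Fin 2) (LocalRing L v)) : Matrix (Fin 2) (Fin 2) (LocalRing L v)).map (Pi.evalRingHom (fun w' : PlacesOver L v => w'.1.adicCompletion L) w))).det) = WithZero.exp (-((2 * N + 1 : ℕ) : ℤ))) :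
    classOrbitalIntegral mH (((((cmLocalIntegralLevel L 2 (Matrix.of fun i j : Fin 2 => if i.val + j.val + 1 = 2 then (1 : L) else 0) v).prod (cmLocalIntegralLevel L 1 (Matrix.of fun i j : Fin 1 => if i.val + j.val + 1 = 1 then (1 : L) else 0) v)) : Subgroup ((cmDatum L 2 (Matrix.of fun i j : Fin 2 => if i.val + j.val + 1 = 2 then (1 : L) else 0)).Local v × (cmDatum L 1 (Matrix.of fun i j : Fin 1 => if i.val + j.val + 1 = 1 then (1 : L) else 0)).Local v)) : Set ((cmDatum L 2 (Matrix.of fun i j : Fin 2 => if i.val + j.val + 1 = 2 then (1 : L) else 0)).Local v × (cmDatum L 1 (Matrix.of fun i j : Fin 1 => if i.val + j.val + 1 = 1 then (1 : L) else 0)).Local v)).indicator fun _ => (1 : ℂ)) (ConjClasses.mk γH) = ((Flicker1998.phiHtwo (Ideal.absNorm v.asIdeal) N : ℚ) : ℂ) := by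
  haveI := compactSpace_centralizer_of_not_exists_isRoot L v w hw hunr γH h2 hint hirr N hN
  exact classOrbitalIntegral_indicator_eq_phiHtwo_of_not_exists_isRoot L v w hw νH hunr hmH hνH hreg h2 hint hirr N hN

end Payer

end Literature.NumberTheory.Automorphic.UnitaryGroup

end
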